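import Summits.HodgeConjecture.HodgeConjecture.Theorems.R90S6TwistedOrbitalIndicatorCount   -- ★ p08 J1′: `epsOrbitalIntegral_indicator_quotientMeasure_eq_mul_ncard_shell` (generic `(ε, K, ν, t)` letters; brings ★ `Rogawski1990.Ch4Sec10`)
import Summits.HodgeConjecture.HodgeConjecture.Theorems.R90S6TwistedShellSign               -- ★ p04 L2-sgn: `even_sum_add_log_of_inv_mul_mul_qsInvolution_mem` (selection rule; brings ★ J2′ `twistedConj_mem_doubleCoset_iff`, ★ F3)
import HarnessLib

/-!
# R90 · S6 «Ch. 14.1–14.5 stable trace formula» — card L4 (DAG row E1.4.4.2.4 ∕ the E1.4.4.3.1 atom): THE SIGN LAYER AT THE ORBITAL-INTEGRAL LEVEL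
# `Σ_ν κ_ν · Φ_ε(δ^ν, 1_{Kϖ^aK}) = (−1)^{Σa − ord det δ} · Σ_ν Φ_ε(δ^ν, 1_{Kϖ^aK})` (`Theorems/R90S6TwistedKappaOrbitalSign.lean`)

Cell `hodgecm-mathlib`, crux H413 (`stmt-HodgeConjecture-24833`), route of record `HCCMUnconditional`; programme R90-TF (brief `director/R90-BRIEF.v2.md`
1f40d54518340a35), section S6 (base `R90-C14`, dealer R90-C14-plan (g2)), seat R90-C14-p04 (g2); CARD L4 dealt BY NAME 2026-09-05T00:59:08Z (R90 bus).  Lane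
`--kind proof --supports stmt-HodgeConjecture-24833 --as helper`; THEOREMS ONLY over ★ `Theorems` ∕ Literature ∕ Mathlib carriers (no definition, no instance, no
notation, no named fact, no kit, no `sorry`); imports = ★ J1′ `Theorems.R90S6TwistedOrbitalIndicatorCount` + ★ L2-sgn `Theorems.R90S6TwistedShellSign` + HarnessLib.

## THE PRINT (Rogawski 1990; pdf page = book page + 5)
§4.10 (4.10.1) p. 56: `Φ^κ_ε(δ, φ) = Σ_{ν ∈ 𝒟_ε(δ∕F)} κ(ν) e(δ^ν) Φ_ε(δ^ν, φ)`; p. 57: «`κ(ν) = ω_{E∕F}(det(t_ν)) = μ(det₀(t_ν))⁻¹`» (Prop. 3.13.1), `δ^ν = δ·t_ν` (§3.11 p. 34,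
«`det(δ′δ⁻¹) = det(α)` lies in `F^×` … coincides with the image of `ν` in `H¹(F, E¹) = F^×∕NE^×` under the determinant map»).  At an inert place with `E_w∕F_v` and `μ_w`
unramified (the situation of the Hecke clause of Prop. 4.10.1 (b)), `ω_{E_w∕F_v} = (−1)^{ord}` on `F_v^×`, so `κ(ν) = (−1)^{ord det δ^ν − ord det δ}` — the unramified
DICTIONARY of ★ L2-sgn (its docstring carries the page lines).

## WHAT IS PROVED
* §1 (G-GENERIC, ★ J1′'s letters `(ε, K, ν, t)`): **`sum_mul_epsOrbitalIntegral_indicator_eq_mul_sum_of_selection`** — for a group `G` with a continuous endomorphism `ε`, an open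
  subgroup `K`, an open twisted-`K`-invariant set `S`, a finite family of base points `d : ι → G` (each with compact ε-centraliser of `t_i`-mass one and finitely many
  twisted-shell cosets `{q ∈ G ⧸ K : q.out⁻¹ d_i ε(q.out) ∈ S}`), weights `κ : ι → ℤˣ` and a sign `s₀ ∈ ℤˣ` satisfying the SELECTION RULE «the twisted shell of `d_i` is
  inhabited ⟹ `κ_i = s₀`»: `Σ_{i ∈ s} κ_i · Φ_ε(d_i, 1_S; ν∕t_i) = s₀ · Σ_{i ∈ s} Φ_ε(d_i, 1_S; ν∕t_i)` (★ J1′: `Φ_ε(d_i, 1_S; ν∕t_i) = ν(K)·#Shell(d_i)`, so an empty shell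
  contributes `0` and an inhabited one carries `κ_i = s₀`).
* §2 (`G = GL_N(K)`, `ε = Θ_σ = UnitaryGroup.qsInvolution σ` packaged as a `MonoidHom` by ★ `qsInvolution_mul`, `K = GL_N(𝒪) = glInt N K`, `S = K·ϖ^a·K`):
  HEAD **`sum_negOnePow_mul_epsOrbitalIntegral_twistedShell`** — with the print's weights as explicit binders `(κ : ι → ℤˣ)`,
  `(hκ : κ i = (log v det δ − log v det d_i).negOnePow)` (`= (−1)^{ord det d_i − ord det δ} = κ(ν)` for `d_i = δ^ν`; `v ϖ = exp(−1)`, `log v = −ord`):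
  `Σ_{i ∈ s} κ_i · Φ_ε(d_i, 1_{Kϖ^aK}; ν∕t_i) = (Σ_j a_j + log v det δ).negOnePow · Σ_{i ∈ s} Φ_ε(d_i, 1_{Kϖ^aK}; ν∕t_i)`, i.e. THE GLOBAL SIGN `(−1)^{Σa − ord det δ}` — §1 with
  `hSK` = ★ J2′ `twistedConj_mem_doubleCoset_iff`, `hS` = openness of `K·ϖ^a·K` from `hK`, and the selection rule discharged by ★ L2-sgn
  `even_sum_add_log_of_inv_mul_mul_qsInvolution_mem` (`q.out⁻¹ d_i Θ(q.out) ∈ Kϖ^aK ⟹ Σa ≡ ord det d_i (mod 2)`).  The ν-index set `s : Finset ι`, the base points `d`, the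
  measures `t_i`, `ν` and the topological ∕ Borel structure on `GL_N(K)` are BINDERS (no class set of §3.11–3.13 is baked in; at a local field `hK` is ★ `isOpen_glInt`, the
  finiteness `hfin` is compactness of `K·ϖ^a·K` modulo the compact centraliser — the consumer's pins, as in ★ J1′).
* §3 (the (4.10.1) reading, ★ `Rogawski1990.Ch4Sec10.epsKappaOrbitalIntegral`, pure algebra, no measure hypothesis):
  **`epsKappaOrbitalIntegral_eq_mul_of_selection`** — if on every class `c` in the stable ε-class of `δ` either `κ δ c = s₀` or `Φ_ε(δ_c, φ) = 0`, then
  `Φ^κ_ε(δ, φ) = s₀ · Φ^{κ ≡ 1}_ε(δ, φ)` (same Kottwitz signs `e`, same measure family); with §2's selection rule this is `Φ^κ_ε(δ, 1_{Kϖ^aK}) = (−1)^{Σa − ord_E det δ} · Φ^st_ε(δ, 1_{Kϖ^aK})`,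
  the form row E1.4.4.3.1 multiplies by `Δ̃(δ) = μ(det₀δ)⁻¹ Δ_{G∕H}(γ)` (★ `TwistedTransferData.DeltaTilde`).
HONEST LABEL: sign bookkeeping over ★ carriers; proves no printed global statement, discharges no citation; count-neutral helper until row E1.4.4.3.1 (`η̂₁` twisted
endoscopic FL) consumes it.  HC_CM is proved only modulo the 7 printed citations (2 remaining named inputs: hLiu418 = stmt-HodgeConjecture-24832,
h413 = stmt-HodgeConjecture-24833) until rung 0 closes; REL ≠ ★ ≠ BUILT.

## Tree search (dedup)
`rg "KappaOrbitalSign|sum_mul_epsOrbitalIntegral|negOnePow_mul_epsOrbitalIntegral|epsKappaOrbitalIntegral_eq_mul"` over `lean/` — no hit (2026-09-05T01:04Z); ★ J1′ is the only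
`epsOrbitalIntegral` evaluation at shells; ★ `Ch4Sec10.epsKappaOrbitalIntegral` has no lemma besides its definition.

## References
* [Rogawski1990] J. D. Rogawski, *Automorphic Representations of Unitary Groups in Three Variables*, Ann. of Math. Stud. 123 (1990): §3.11 p. 34, Prop. 3.13.1 p. 36,
  §4.10 (4.10.1) p. 56, p. 57 (`κ(ν) = ω_{E∕F}(det t_ν)`, `Δ̃`), Prop. 4.10.1 (b) p. 58.
* [Kottwitz1986BaseChangeUnits] R. E. Kottwitz, *Base change for unit elements of Hecke algebras*, Compositio Math. 60 (1986): §1 pp. 239–243 (twisted orbital integrals of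
  `1_{K_L}` as counts of `σ`-twisted fixed cosets).
* [Laumon1996] G. Laumon, *Cohomology of Drinfeld Modular Varieties*, Part I (1996): Lemma (5.3.2) p. 136 (the fibre count behind ★ J1′).
-/

set_option autoImplicit false
-- the mandated namespace repeats the single-problem summit's segment (`HodgeConjecture.HodgeConjecture`)
set_option linter.dupNamespace false

noncomputable section

open MeasureTheory Measure Topology Set
open scoped Matrix MatrixGroups Valued WithZero Pointwise
open Literature.MeasureTheory.Group Literature.NumberTheory.Automorphic Literature.NumberTheory.Automorphic.HermitianLattice
  Literature.NumberTheory.Automorphic.UnitaryLatticeTree Literature.NumberTheory.Rogawski1990.Ch4Sec10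

namespace Summit.HodgeConjecture.HodgeConjecture.R90.S6

/-! ## §1 Generic: a `κ`-weighted sum of twisted orbital integrals of `1_S` obeying a selection rule is the global sign times the unweighted sum -/

section Generic

variable {G : Type*} [Group G] [TopologicalSpace G] [IsTopologicalGroup G] [LocallyCompactSpace G]
  [SecondCountableTopology G] [T2Space G] [MeasurableSpace G] [BorelSpace G]
  (ε : G →* G) (K : Subgroup G) {ι : Type*} (s : Finset ι) (d : ι → G)
  [∀ i, MeasurableSpace (G ⧸ epsCentralizer ε (d i))] [∀ i, BorelSpace (G ⧸ epsCentralizer ε (d i))]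
  [hC : ∀ i, IsClosed ((epsCentralizer ε (d i) : Subgroup G) : Set G)]
  (t : ∀ i, Measure (epsCentralizer ε (d i))) [∀ i, (t i).IsMulLeftInvariant]
  [∀ i, IsFiniteMeasureOnCompacts (t i)] [∀ i, (t i).IsOpenPosMeasure] [∀ i, (t i).IsInvInvariant] [∀ i, SFinite (t i)]
  (ν : Measure G) [IsHaarMeasure ν] [ν.IsMulRightInvariant]
  [∀ i, CompactSpace (epsCentralizer ε (d i))]
  (hε : Continuous ε) {S : Set G} (hS : IsOpen S) (hSK : ∀ k : G, k ∈ K → ∀ g : G, k * g * (ε k)⁻¹ ∈ S ↔ g ∈ S)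

include hε hS hSK in
/-- **THE SIGN LAYER, generic form.**  For a finite family of base points `d_i` (each with compact ε-centraliser of `t_i`-mass one and finitely many twisted-shell cosets), weights
`κ_i ∈ ℤˣ` and a sign `s₀ ∈ ℤˣ` obeying the SELECTION RULE «`{q ∈ G ⧸ K : q.out⁻¹ d_i ε(q.out) ∈ S}` inhabited ⟹ `κ_i = s₀`»:
`Σ_{i ∈ s} κ_i · Φ_ε(d_i, 1_S; ν∕t_i) = s₀ · Σ_{i ∈ s} Φ_ε(d_i, 1_S; ν∕t_i)` — by ★ J1′ each `Φ_ε(d_i, 1_S; ν∕t_i) = ν(K) · #Shell(d_i)`, so an empty shell contributes `0` to both sides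
and an inhabited one carries the common sign.  (The shape of (4.10.1) at a Hecke basis element: `d_i = δ^ν`, `κ_i = κ(ν)`.) [cite: Rogawski1990, §4.10 (4.10.1) p. 56, p. 57]
[cite: Kottwitz1986BaseChangeUnits, §1 pp. 239–243] -/
theorem sum_mul_epsOrbitalIntegral_indicator_eq_mul_sum_of_selection (hK : IsOpen (K : Set G)) (ht : ∀ i ∈ s, t i Set.univ = 1)
    (hfin : ∀ i ∈ s, {q : G ⧸ K | q.out⁻¹ * d i * ε q.out ∈ S}.Finite) (κ : ι → ℤˣ) (s₀ : ℤˣ)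
    (hsel : ∀ i ∈ s, {q : G ⧸ K | q.out⁻¹ * d i * ε q.out ∈ S}.Nonempty → κ i = s₀) :
    ∑ i ∈ s, (((κ i : ℤˣ) : ℤ) : ℝ) *
        epsOrbitalIntegral ε (d i) (S.indicator (1 : G → ℝ)) (quotientMeasure (epsCentralizer ε (d i)) (t i) (hC i) ν) =
      (((s₀ : ℤˣ) : ℤ) : ℝ) *
        ∑ i ∈ s, epsOrbitalIntegral ε (d i) (S.indicator (1 : G → ℝ)) (quotientMeasure (epsCentralizer ε (d i)) (t i) (hC i) ν) := by
  rw [Finset.mul_sum]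
  refine Finset.sum_congr rfl fun i hi => ?_
  rw [epsOrbitalIntegral_indicator_quotientMeasure_eq_mul_ncard_shell ε (d i) K (t i) ν hε hS hSK hK (ht i hi) (hfin i hi)]
  rcases ({q : G ⧸ K | q.out⁻¹ * d i * ε q.out ∈ S}).eq_empty_or_nonempty with h0 | hne
  · rw [h0, Set.ncard_empty, Nat.cast_zero, mul_zero, mul_zero, mul_zero]
  · rw [hsel i hi hne]

end Generic

/-! ## §2 `G = GL_N(K)`, `ε = Θ_σ`, `S = GL_N(𝒪)·ϖ^a·GL_N(𝒪)`: the weights `κ_i = (−1)^{ord det d_i − ord det δ}` obey the selection rule with global sign `(−1)^{Σa − ord det δ}` -/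

section GeneralLinear

variable {K : Type*} [Field K] [Valued K ℤᵐ⁰] [ValuativeRel K] [(Valued.v : Valuation K ℤᵐ⁰).Compatible] {σ : K →+* K} {N : ℕ}
  {ϖ : K} (hϖ : IsUniformizingElement ϖ) (hvϖ : Valued.v ϖ = WithZero.exp (-1 : ℤ))

omit [ValuativeRel K] [(Valued.v : Valuation K ℤᵐ⁰).Compatible] in
/-- A Cartan shell `GL_N(𝒪)·d·GL_N(𝒪)` — indeed any `U·{d}·U` for an open `U` — is OPEN in `GL_N(K)` (pointwise products with an open set are open in a topological group).
[cite: Kottwitz1986BaseChangeUnits, §1 p. 239] -/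
theorem isOpen_doubleCoset_of_isOpen {U : Set (GL (Fin N) K)} (hU : IsOpen U) (d : GL (Fin N) K) : IsOpen (U * {d} * U) :=
  (hU.mul_right).mul_right

include hvϖ in
/-- **HEAD — THE SIGN LAYER AT THE ORBITAL-INTEGRAL LEVEL, `GL_N`.**  `G = GL_N(K)` over a discretely valued field (`v ϖ = exp(−1)`), `Θ = Θ_σ` the quasi-split involution
(`σ` valuation-preserving, `Θ` continuous) as a `MonoidHom` (★ `qsInvolution_mul`), `K = GL_N(𝒪)` open, shell `S = K·ϖ^a·K` (any exponent vector `a`); a reference base point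
`δ` and a finite family `d : ι → GL_N(K)` of base points (think: representatives `δ^ν = δ·t_ν` of the ε-classes in the stable ε-class of `δ`), each with compact Θ-centraliser of
`t_i`-mass one and finitely many twisted-shell cosets (★ J1′'s hypotheses, per `i`); weights `κ : ι → ℤˣ` pinned by `hκ` to the print's
`κ(ν) = ω_{E∕F}(det(δ^νδ⁻¹)) = (−1)^{ord det d_i − ord det δ}` (unramified dictionary; `log v = −ord`).  THEN
`Σ_{i ∈ s} κ_i · Φ_Θ(d_i, 1_{Kϖ^aK}; ν∕t_i) = (−1)^{Σ_j a_j − ord det δ} · Σ_{i ∈ s} Φ_Θ(d_i, 1_{Kϖ^aK}; ν∕t_i)` (the sign spelled `(Σ_j a_j + log v det δ).negOnePow`): the `κ`-twisted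
orbital integral (4.10.1) of a Hecke basis element is the GLOBAL determinant-parity sign times the stable one.  Proof = §1 with ★ J2′ `twistedConj_mem_doubleCoset_iff`
(`hSK`), `isOpen_doubleCoset_of_isOpen` (`hS`) and the selection rule ★ L2-sgn `even_sum_add_log_of_inv_mul_mul_qsInvolution_mem`.
[cite: Rogawski1990, §4.10 (4.10.1) p. 56, p. 57, Prop. 4.10.1 (b) p. 58] [cite: Kottwitz1986BaseChangeUnits, §1 pp. 239–243] -/
theorem sum_negOnePow_mul_epsOrbitalIntegral_twistedShell [LocallyCompactSpace (GL (Fin N) K)] [SecondCountableTopology (GL (Fin N) K)]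
    [MeasurableSpace (GL (Fin N) K)] [BorelSpace (GL (Fin N) K)]
    (hvσ : ∀ a, Valued.v (σ a) = Valued.v a) {ι : Type*} (s : Finset ι) (d : ι → GL (Fin N) K) (δ : GL (Fin N) K) (a : Fin N → ℤ)
    [∀ i, MeasurableSpace (GL (Fin N) K ⧸
      epsCentralizer (MonoidHom.mk' (UnitaryGroup.qsInvolution σ) (UnitaryGroup.qsInvolution_mul σ)) (d i))]
    [∀ i, BorelSpace (GL (Fin N) K ⧸
      epsCentralizer (MonoidHom.mk' (UnitaryGroup.qsInvolution σ) (UnitaryGroup.qsInvolution_mul σ)) (d i))]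
    [hC : ∀ i, IsClosed ((epsCentralizer (MonoidHom.mk' (UnitaryGroup.qsInvolution σ) (UnitaryGroup.qsInvolution_mul σ)) (d i) :
      Subgroup (GL (Fin N) K)) : Set (GL (Fin N) K))]
    (t : ∀ i, Measure (epsCentralizer (MonoidHom.mk' (UnitaryGroup.qsInvolution σ) (UnitaryGroup.qsInvolution_mul σ)) (d i)))
    [∀ i, (t i).IsMulLeftInvariant] [∀ i, IsFiniteMeasureOnCompacts (t i)] [∀ i, (t i).IsOpenPosMeasure] [∀ i, (t i).IsInvInvariant]
    [∀ i, SFinite (t i)] (ν : Measure (GL (Fin N) K)) [IsHaarMeasure ν] [ν.IsMulRightInvariant]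
    [∀ i, CompactSpace (epsCentralizer (MonoidHom.mk' (UnitaryGroup.qsInvolution σ) (UnitaryGroup.qsInvolution_mul σ)) (d i))]
    (hΘ : Continuous ⇑(MonoidHom.mk' (UnitaryGroup.qsInvolution σ) (UnitaryGroup.qsInvolution_mul σ) : GL (Fin N) K →* GL (Fin N) K))
    (hK : IsOpen (glInt N K : Set (GL (Fin N) K))) (ht : ∀ i ∈ s, t i Set.univ = 1)
    (hfin : ∀ i ∈ s, {q : GL (Fin N) K ⧸ glInt N K |
      q.out⁻¹ * d i * UnitaryGroup.qsInvolution σ q.out ∈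
        (glInt N K : Set (GL (Fin N) K)) * {zpowDiagGL hϖ.ne_zero a} * (glInt N K : Set (GL (Fin N) K))}.Finite)
    (κ : ι → ℤˣ)
    (hκ : ∀ i ∈ s, κ i = (WithZero.log (Valued.v ((δ : GL (Fin N) K) : Matrix (Fin N) (Fin N) K).det) -
      WithZero.log (Valued.v ((d i : GL (Fin N) K) : Matrix (Fin N) (Fin N) K).det)).negOnePow) :
    ∑ i ∈ s, (((κ i : ℤˣ) : ℤ) : ℝ) *
        epsOrbitalIntegral (MonoidHom.mk' (UnitaryGroup.qsInvolution σ) (UnitaryGroup.qsInvolution_mul σ)) (d i)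
          (((glInt N K : Set (GL (Fin N) K)) * {zpowDiagGL hϖ.ne_zero a} * (glInt N K : Set (GL (Fin N) K))).indicator (1 : GL (Fin N) K → ℝ))
          (quotientMeasure (epsCentralizer (MonoidHom.mk' (UnitaryGroup.qsInvolution σ) (UnitaryGroup.qsInvolution_mul σ)) (d i)) (t i) (hC i) ν) =
      ((((∑ j, a j + WithZero.log (Valued.v ((δ : GL (Fin N) K) : Matrix (Fin N) (Fin N) K).det)).negOnePow : ℤˣ) : ℤ) : ℝ) *
        ∑ i ∈ s, epsOrbitalIntegral (MonoidHom.mk' (UnitaryGroup.qsInvolution σ) (UnitaryGroup.qsInvolution_mul σ)) (d i)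
          (((glInt N K : Set (GL (Fin N) K)) * {zpowDiagGL hϖ.ne_zero a} * (glInt N K : Set (GL (Fin N) K))).indicator (1 : GL (Fin N) K → ℝ))
          (quotientMeasure (epsCentralizer (MonoidHom.mk' (UnitaryGroup.qsInvolution σ) (UnitaryGroup.qsInvolution_mul σ)) (d i)) (t i) (hC i) ν) := by
  refine sum_mul_epsOrbitalIntegral_indicator_eq_mul_sum_of_selection
    (MonoidHom.mk' (UnitaryGroup.qsInvolution σ) (UnitaryGroup.qsInvolution_mul σ)) (glInt N K) s d t ν hΘ
    (isOpen_doubleCoset_of_isOpen hK _) (twistedConj_mem_doubleCoset_iff hvσ _) hK ht hfin κ _ fun i hi hne => ?_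
  -- the selection rule: an inhabited twisted shell of `d i` forces `Σ a ≡ ord det (d i) (mod 2)`, so `κ i` is the global sign
  obtain ⟨q, hq⟩ := hne
  obtain ⟨r, hr⟩ := even_sum_add_log_of_inv_mul_mul_qsInvolution_mem hϖ hvϖ hvσ hq
  rw [hκ i hi]
  exact (Int.negOnePow_eq_iff _ _).2 ⟨-r, by omega⟩

end GeneralLinear

/-! ## §3 The (4.10.1) reading: `Φ^κ_ε(δ, φ) = s₀ · Φ^{κ ≡ 1}_ε(δ, φ)` under a class-wise selection rule (★ `Ch4Sec10.epsKappaOrbitalIntegral`, pure algebra) -/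

section Kappa

variable {Gt : Type*} [Group Gt] (ε : Gt →* Gt) {Z' : Subgroup Gt} [∀ δ : Gt, MeasurableSpace (Gt ⧸ epsCentralizer ε δ)]

/-- **`Φ^κ_ε(δ, φ) = s₀ · Φ^{κ ≡ 1}_ε(δ, φ)` UNDER A SELECTION RULE.**  In the abstract currency of ★ `Rogawski1990.Ch4Sec10` ((4.10.1):
`Φ^κ_ε(δ, φ) = Σᶠ_{c ⊂ 𝒪_{ε-st}(δ)} κ(δ, c) · e(δ_c) · Φ_ε(δ_c, φ; m_c)`, classes `c` modulo `Z′`, representatives `δ_c = out c`): if on every class `c` of the stable ε-class of `δ` EITHER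
`κ(δ, c) = s₀` OR `Φ_ε(δ_c, φ; m_c) = 0`, then `Φ^κ_ε(δ, φ) = s₀ · Φ^{κ ≡ 1}_ε(δ, φ)` (same Kottwitz signs `e`, same measure family; no finiteness needed, `ℂ` has no zero divisors).
With §2 (`φ = 1_{Kϖ^aK}`, `κ(δ, c) = (−1)^{ord det δ_c − ord det δ}`, ★ J1′ + ★ L2-sgn: the wrong-parity classes have `Φ_ε = 0`) this is
`Φ^κ_ε(δ, 1_{Kϖ^aK}) = (−1)^{Σa − ord_E det δ} · Φ^st_ε(δ, 1_{Kϖ^aK})`, the form row E1.4.4.3.1 multiplies by `Δ̃(δ)` (★ `TwistedTransferData.DeltaTilde`, `PhiEpsKappa`, `PhiEpsSt`).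
[cite: Rogawski1990, §4.10 (4.10.1) p. 56, p. 57, Prop. 4.10.1 (b) p. 58] -/
theorem epsKappaOrbitalIntegral_eq_mul_of_selection (stε : Gt → Gt → Prop) (κ : Gt → EpsConjClassesMod ε Z' → ℂ) (e : Gt → ℂ)
    (m : EpsOrbitalMeasureFamily ε Z') (φ : Gt → ℂ) (δ : Gt) (s₀ : ℂ)
    (hsel : ∀ c : EpsConjClassesMod ε Z', stε δ (Quotient.out c) → κ δ c = s₀ ∨ classEpsOrbitalIntegral ε m φ c = 0) :
    epsKappaOrbitalIntegral ε stε κ e m φ δ = s₀ * epsKappaOrbitalIntegral ε stε (fun _ _ => 1) e m φ δ := by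
  unfold epsKappaOrbitalIntegral
  rw [mul_finsum_mem]
  refine finsum_mem_congr rfl fun c hc => ?_
  rcases hsel c hc with h | h
  · rw [h, one_mul, mul_assoc]
  · rw [h, mul_zero, mul_zero, mul_zero]

end Kappa

end Summit.HodgeConjecture.HodgeConjecture.R90.S6

end
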